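import Mathlib
import HarnessLib
import Summits.HubbardSuperconductivity.HubbardSuperconductivity.Theorems.KLProgrammeC4aTangencyCalculusAll

/-!
# Route `KLProgramme` — crux C4a, S3 brick (B2, ALL ORDERS): the all-orders JET COMPARISON
# `|∂ⁿ_t f(X + δ·Δ) − ∂ⁿ_t f(X)|₀ ≤ |δ|·(n+1)!·K·D^{n+1}` by a mean value in the parameter

Cell `gate-hubbard-kl`, seat hubbard-kl-k3c3-p3 (g23; row «implicit-function / monotonicity route»).  Located brick «(B2)-TAN-ALL», sequel of
`…C4aTangencyCalculusAll`, for the (C)-closer lane hubbard-kl-c4a-1 (stub (C) `stub_twoLeg_curvature` of `KLRegimeEngineV17F2`,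
stmt-HubbardSuperconductivity-20437; memo HOME/hubbard-kl-c4a-1/C4A-PLAN.md §24.8: the reductions `e → 0` and `(ρ,ϑ) → (ρ_T, ϑ_T)` of the
partner-band jets, done at order 1 by `abs_deriv_comp_add_sub_le`, at order 2 by `abs_jet_two_sub_le`, at order 3 by
`abs_iteratedDeriv_three_comp_sub_le` — one monomial expansion per order).  Here ONE statement serves every order: put the perturbation on a
parameter, `Λ(σ, t) := X(t) + σ·Δ(t)` on `ℝ²`, so that `σ ↦ ∂ⁿ_t|₀ f(X + σΔ) = Dⁿ(f∘Λ)(σ,0)[vⁿ]` (`v = (0,1)`) is differentiable with derivative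
`D^{n+1}(f∘Λ)(σ,0)[w, vⁿ]` (`w = (1,0)`, `hasDerivAt_iteratedFDeriv_line`); the mean value theorem on `[0, δ]` and the composition bound
`norm_iteratedFDeriv_comp_le` (with `‖DⁱΛ(σ,0)‖ ≤ ‖X⁽ⁱ⁾(0)‖ + |σ|‖Δ⁽ⁱ⁾(0)‖ + i‖Δ⁽ⁱ⁻¹⁾(0)‖` — Leibniz for the bilinear `σ·Δ(t)`) give

* **`abs_iteratedDeriv_comp_add_smul_sub_le`** — `f ∈ C^{n+1}`, `‖Dⁱf‖ ≤ K` (`1 ≤ i ≤ n+1`), `X, Δ ∈ C^{n+1}`,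
  `‖X⁽ⁱ⁾(0)‖ + |δ|·‖Δ⁽ⁱ⁾(0)‖ + i·‖Δ⁽ⁱ⁻¹⁾(0)‖ ≤ Dⁱ` (`1 ≤ i ≤ n+1`) ⟹ `|∂ⁿ_t f(X + δ•Δ) − ∂ⁿ_t f(X)|₀ ≤ |δ|·(n+1)!·K·D^{n+1}`.

In the instance file `δ = e` (resp. the distance to the tangency configuration) and `Δ = (Φ(0,·) − Φ(e,·))/e ∘ shift` (resp. the rescaled
pair-difference path), whose jets are the radial rows / the curve table; only JETS AT `t = 0` are asked, as in the landed order-≤ 3 files.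
Helpers: `iteratedFDeriv_clm_add_two` (a continuous linear map has vanishing derivatives of order `≥ 2`), `norm_iteratedFDeriv_fst_smul_le`.

Pure calculus; nothing about the model's sizes; nothing asserts superconductivity.  References: FST II CPAM 51 (1998) §3; BGM 2006 §2.4
[cite: BenfattoGiulianiMastropietro2006].
-/

noncomputable section

namespace Summit.HubbardSuperconductivity.HubbardSuperconductivity.Theorems.C4a

set_option linter.dupNamespace false -- summit = problem name (single-conjunct summit), D-0017

open Real Set Filter Finset
open scoped Topology

section Compare

variable {V : Type*} [NormedAddCommGroup V] [NormedSpace ℝ V]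

/-- The second Fréchet derivative and beyond of a continuous linear map vanish. -/
theorem iteratedFDeriv_clm_add_two {E F : Type*} [NormedAddCommGroup E] [NormedSpace ℝ E] [NormedAddCommGroup F] [NormedSpace ℝ F]
    (A : E →L[ℝ] F) (k : ℕ) (x : E) : iteratedFDeriv ℝ (k + 2) (fun y => A y) x = 0 := by
  ext m
  rw [iteratedFDeriv_succ_apply_right]
  simp [iteratedFDeriv_const_of_ne (Nat.succ_ne_zero k)]

/-- **Leibniz for the bilinear perturbation term**: for `x = (σ, t₀)` and `1 ≤ i ≤ N`,
`‖Dⁱ[(σ,t) ↦ σ • Δ(t)](x)‖ ≤ |σ|·‖Δ⁽ⁱ⁾(t₀)‖ + i·‖Δ⁽ⁱ⁻¹⁾(t₀)‖`. -/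
theorem norm_iteratedFDeriv_fst_smul_le {Δ : ℝ → V} {N : WithTop ℕ∞} (hΔ : ContDiff ℝ N Δ) {i : ℕ} (hi1 : 1 ≤ i)
    (hi : (i : WithTop ℕ∞) ≤ N) (x : ℝ × ℝ) :
    ‖iteratedFDeriv ℝ i (fun y : ℝ × ℝ => (ContinuousLinearMap.fst ℝ ℝ ℝ y) • Δ (ContinuousLinearMap.snd ℝ ℝ ℝ y)) x‖ ≤
      |x.1| * ‖iteratedDeriv i Δ x.2‖ + i * ‖iteratedDeriv (i - 1) Δ x.2‖ := by
  have hfst : ContDiff ℝ N (fun y : ℝ × ℝ => ContinuousLinearMap.fst ℝ ℝ ℝ y) := (ContinuousLinearMap.fst ℝ ℝ ℝ).contDiff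
  have hsndΔ : ContDiff ℝ N (fun y : ℝ × ℝ => Δ (ContinuousLinearMap.snd ℝ ℝ ℝ y)) := hΔ.comp (ContinuousLinearMap.snd ℝ ℝ ℝ).contDiff
  have hsnd1 : ‖ContinuousLinearMap.snd ℝ ℝ ℝ‖ ≤ 1 := ContinuousLinearMap.norm_snd_le ℝ ℝ ℝ
  refine (norm_iteratedFDeriv_smul_le hfst hsndΔ x hi).trans ?_
  -- split off the terms `j = 0, 1`; the rest vanish since `D^{j+2} fst = 0`
  obtain ⟨k, rfl⟩ : ∃ k, i = k + 1 := ⟨i - 1, by omega⟩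
  rw [Finset.sum_range_succ', Finset.sum_range_succ']
  have hrest : ∑ j ∈ Finset.range k, ((k + 1).choose (j + 1 + 1) : ℝ) *
      ‖iteratedFDeriv ℝ (j + 1 + 1) (fun y : ℝ × ℝ => ContinuousLinearMap.fst ℝ ℝ ℝ y) x‖ *
      ‖iteratedFDeriv ℝ (k + 1 - (j + 1 + 1)) (fun y : ℝ × ℝ => Δ (ContinuousLinearMap.snd ℝ ℝ ℝ y)) x‖ = 0 := by
    refine Finset.sum_eq_zero fun j _ => ?_
    rw [iteratedFDeriv_clm_add_two (ContinuousLinearMap.fst ℝ ℝ ℝ) j x, norm_zero, mul_zero, zero_mul]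
  rw [hrest, zero_add]
  -- `j = 1`: `‖D¹ fst‖ = ‖fst‖ ≤ 1`, `‖D^{k} (Δ∘snd)‖ ≤ ‖Δ^{(k)}‖`
  have h1 : ‖iteratedFDeriv ℝ (0 + 1) (fun y : ℝ × ℝ => ContinuousLinearMap.fst ℝ ℝ ℝ y) x‖ ≤ 1 := by
    rw [← norm_iteratedFDeriv_fderiv, norm_iteratedFDeriv_zero, (ContinuousLinearMap.fst ℝ ℝ ℝ).fderiv]
    exact ContinuousLinearMap.norm_fst_le ℝ ℝ ℝ
  have h0 : ‖iteratedFDeriv ℝ 0 (fun y : ℝ × ℝ => ContinuousLinearMap.fst ℝ ℝ ℝ y) x‖ = |x.1| := by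
    rw [norm_iteratedFDeriv_zero, Real.norm_eq_abs]; rfl
  have hk0 : (k + 1 - (0 + 1) : ℕ) = k := by omega
  have hk1 : (k + 1 - 0 : ℕ) = k + 1 := by omega
  have hkN : ((k : ℕ) : WithTop ℕ∞) ≤ N := le_trans (by exact_mod_cast Nat.le_succ k) hi
  have tA := norm_iteratedFDeriv_comp_clm_le hΔ (ContinuousLinearMap.snd ℝ ℝ ℝ) hsnd1 hkN x
  have tB := norm_iteratedFDeriv_comp_clm_le hΔ (ContinuousLinearMap.snd ℝ ℝ ℝ) hsnd1 hi x
  rw [hk0, hk1]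
  simp only [Nat.choose_zero_right, Nat.cast_one, one_mul, zero_add, Nat.choose_one_right, ContinuousLinearMap.coe_snd'] at tA tB ⊢
  rw [h0]
  have e3 : 0 ≤ ((k + 1 : ℕ) : ℝ) := by positivity
  have p1 := mul_le_mul (mul_le_mul_of_nonneg_left h1 e3) tA (norm_nonneg _) (by positivity)
  have p2 := mul_le_mul_of_nonneg_left tB (abs_nonneg x.1)
  linarith

/-- **THE ALL-ORDERS JET COMPARISON.**  `f ∈ C^{n+1}` with `‖Dⁱf‖ ≤ K` (`1 ≤ i ≤ n+1`); `X, Δ : ℝ → V` of class `C^{n+1}`; `δ ∈ ℝ`; a constant `D`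
with `‖X⁽ⁱ⁾(0)‖ + |δ|·‖Δ⁽ⁱ⁾(0)‖ + i·‖Δ⁽ⁱ⁻¹⁾(0)‖ ≤ Dⁱ` for `1 ≤ i ≤ n+1`.  Then
`|∂ⁿ_t|₀ f(X(t) + δ•Δ(t)) − ∂ⁿ_t|₀ f(X(t))| ≤ |δ|·(n+1)!·K·D^{n+1}` — mean value in the parameter `σ ∈ [0, δ]` of
`σ ↦ Dⁿ(f∘Λ)(σ,0)[vⁿ]`, `Λ(σ,t) = X(t) + σΔ(t)`. [folklore] -/
theorem abs_iteratedDeriv_comp_add_smul_sub_le {f : V → ℝ} {n : ℕ} {N : WithTop ℕ∞} (hf : ContDiff ℝ N f)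
    (hn : ((n + 1 : ℕ) : WithTop ℕ∞) ≤ N) {K : ℝ} (hK : ∀ i, 1 ≤ i → i ≤ n + 1 → ∀ x, ‖iteratedFDeriv ℝ i f x‖ ≤ K)
    {X Δ : ℝ → V} (hX : ContDiff ℝ N X) (hΔ : ContDiff ℝ N Δ) (δ : ℝ) {D : ℝ}
    (hD : ∀ i, 1 ≤ i → i ≤ n + 1 → ‖iteratedDeriv i X 0‖ + |δ| * ‖iteratedDeriv i Δ 0‖ + i * ‖iteratedDeriv (i - 1) Δ 0‖ ≤ D ^ i) :
    |iteratedDeriv n (fun t : ℝ => f (X t + δ • Δ t)) 0 - iteratedDeriv n (fun t : ℝ => f (X t)) 0| ≤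
      |δ| * ((n + 1).factorial * K * D ^ (n + 1)) := by
  have hn1 : 1 ≤ n + 1 := by omega
  have hK0 : 0 ≤ K := (norm_nonneg _).trans (hK 1 le_rfl hn1 0)
  have hfN : ContDiff ℝ (n + 1 : ℕ) f := hf.of_le hn
  have hXN : ContDiff ℝ (n + 1 : ℕ) X := hX.of_le hn
  have hΔN : ContDiff ℝ (n + 1 : ℕ) Δ := hΔ.of_le hn
  have hnn : ((n : ℕ) : WithTop ℕ∞) ≤ (n + 1 : ℕ) := by exact_mod_cast Nat.le_succ n
  -- the two-variable function `P(σ, t) = f(X(t) + σΔ(t))`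
  set Λ : ℝ × ℝ → V := fun x => X (ContinuousLinearMap.snd ℝ ℝ ℝ x) +
    (ContinuousLinearMap.fst ℝ ℝ ℝ x) • Δ (ContinuousLinearMap.snd ℝ ℝ ℝ x) with hΛ
  set P : ℝ × ℝ → ℝ := fun x => f (Λ x) with hP
  have hΛ1 : ContDiff ℝ (n + 1 : ℕ) (fun x : ℝ × ℝ => X (ContinuousLinearMap.snd ℝ ℝ ℝ x)) := hXN.comp (ContinuousLinearMap.snd ℝ ℝ ℝ).contDiff
  have hΛ2 : ContDiff ℝ (n + 1 : ℕ) (fun x : ℝ × ℝ => (ContinuousLinearMap.fst ℝ ℝ ℝ x) • Δ (ContinuousLinearMap.snd ℝ ℝ ℝ x)) :=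
    (ContinuousLinearMap.fst ℝ ℝ ℝ).contDiff.smul (hΔN.comp (ContinuousLinearMap.snd ℝ ℝ ℝ).contDiff)
  have hΛc : ContDiff ℝ (n + 1 : ℕ) Λ := hΛ1.add hΛ2
  have hPc : ContDiff ℝ (n + 1 : ℕ) P := hfN.comp hΛc
  set q : ℝ × ℝ := (0, 0) with hq
  set v : ℝ × ℝ := (0, 1) with hv
  set w : ℝ × ℝ := (1, 0) with hw
  have hline : ∀ σ t : ℝ, q + σ • w + t • v = (σ, t) := fun σ t => by
    rw [hq, hv, hw]; refine Prod.ext ?_ ?_ <;> simp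
  -- `g(σ) = Dⁿ P(σ,0)[vⁿ] = ∂ⁿ_t|₀ f(X + σΔ)`
  have hg_eq : ∀ σ : ℝ, iteratedFDeriv ℝ n P (q + σ • w) (fun _ => v) = iteratedDeriv n (fun t : ℝ => f (X t + σ • Δ t)) 0 := fun σ => by
    have h := iteratedDeriv_comp_line P hPc hnn (q + σ • w) v 0
    rw [zero_smul, add_zero] at h
    rw [← h]
    congr 1
    funext t
    simp only [hline σ t, hP, hΛ, ContinuousLinearMap.coe_fst', ContinuousLinearMap.coe_snd']
  have hg : ∀ σ : ℝ, HasDerivAt (fun σ : ℝ => iteratedFDeriv ℝ n P (q + σ • w) (fun _ => v))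
      (iteratedFDeriv ℝ (n + 1) P (q + σ • w) (Fin.cons w fun _ => v)) σ := fun σ => hasDerivAt_iteratedFDeriv_line hPc le_rfl q w _ σ
  -- the derivative bound on `[0, δ]`
  have hvn : ‖v‖ = 1 := by rw [hv]; simp [Prod.norm_def]
  have hwn : ‖w‖ = 1 := by rw [hw]; simp [Prod.norm_def]
  have hbound : ∀ σ ∈ uIcc (0 : ℝ) δ, ‖iteratedFDeriv ℝ (n + 1) P (q + σ • w) (Fin.cons w fun _ => v)‖ ≤ (n + 1).factorial * K * D ^ (n + 1) := by
    intro σ hσ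
    have hσδ : |σ| ≤ |δ| := abs_le_abs_of_mem_uIcc_zero hσ
    have hx : q + σ • w = (σ, 0) := by have h := hline σ 0; rwa [zero_smul, add_zero] at h
    refine (ContinuousMultilinearMap.le_opNorm _ _).trans ?_
    rw [Fin.prod_univ_succ]
    simp only [Fin.cons_zero, Fin.cons_succ, Fin.prod_const, hvn, hwn, one_pow, mul_one]
    rw [hx]
    -- composition bound at the point `(σ, 0)` after shifting `f` by `f(Λ(σ,0))`
    set x : ℝ × ℝ := (σ, 0) with hxdef
    set g : V → ℝ := fun y => f y - f (Λ x) with hgdef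
    have hgc : ContDiff ℝ (n + 1 : ℕ) g := hfN.sub contDiff_const
    have hshift : iteratedFDeriv ℝ (n + 1) P x = iteratedFDeriv ℝ (n + 1) (g ∘ Λ) x := by
      have e2 : g ∘ Λ = P - fun _ => f (Λ x) := rfl
      rw [e2, iteratedFDeriv_sub_apply hPc.contDiffAt contDiff_const.contDiffAt, iteratedFDeriv_const_of_ne (by omega : n + 1 ≠ 0)]
      simp only [Pi.zero_apply, sub_zero]
    rw [hshift]
    refine norm_iteratedFDeriv_comp_le hgc hΛc le_rfl x (C := K) (D := D) (fun i hi => ?_) (fun i hi1 hi => ?_)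
    · rcases Nat.eq_zero_or_pos i with h0i | hpos
      · subst h0i; rw [norm_iteratedFDeriv_zero, hgdef]; simp only [sub_self, norm_zero]; exact hK0
      · have e : iteratedFDeriv ℝ i g (Λ x) = iteratedFDeriv ℝ i f (Λ x) := by
          have eg : g = f - fun _ => f (Λ x) := rfl
          rw [eg, iteratedFDeriv_sub_apply (hfN.of_le (by exact_mod_cast hi)).contDiffAt contDiff_const.contDiffAt,
            iteratedFDeriv_const_of_ne (by omega : i ≠ 0)]
          simp only [Pi.zero_apply, sub_zero]
        rw [e]; exact hK i hpos hi _
    · have hiN : (i : WithTop ℕ∞) ≤ (n + 1 : ℕ) := by exact_mod_cast hi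
      have hsnd1 : ‖ContinuousLinearMap.snd ℝ ℝ ℝ‖ ≤ 1 := ContinuousLinearMap.norm_snd_le ℝ ℝ ℝ
      have t1 := norm_iteratedFDeriv_comp_clm_le hXN (ContinuousLinearMap.snd ℝ ℝ ℝ) hsnd1 hiN x
      have t2 := norm_iteratedFDeriv_fst_smul_le hΔN hi1 hiN x
      have hx1 : x.1 = σ := rfl
      have hx2 : x.2 = 0 := rfl
      have hx2' : ContinuousLinearMap.snd ℝ ℝ ℝ x = 0 := rfl
      rw [hx1, hx2] at t2
      rw [hx2'] at t1
      have hadd : iteratedFDeriv ℝ i Λ x = iteratedFDeriv ℝ i (fun x : ℝ × ℝ => X (ContinuousLinearMap.snd ℝ ℝ ℝ x)) x +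
          iteratedFDeriv ℝ i (fun x : ℝ × ℝ => (ContinuousLinearMap.fst ℝ ℝ ℝ x) • Δ (ContinuousLinearMap.snd ℝ ℝ ℝ x)) x := by
        have eΛ : Λ = (fun x : ℝ × ℝ => X (ContinuousLinearMap.snd ℝ ℝ ℝ x)) +
            fun x : ℝ × ℝ => (ContinuousLinearMap.fst ℝ ℝ ℝ x) • Δ (ContinuousLinearMap.snd ℝ ℝ ℝ x) := rfl
        rw [eΛ, iteratedFDeriv_add_apply (hΛ1.of_le hiN).contDiffAt (hΛ2.of_le hiN).contDiffAt]
      rw [hadd]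
      refine (norm_add_le _ _).trans ?_
      have hδi := hD i hi1 hi
      have hm : |σ| * ‖iteratedDeriv i Δ 0‖ ≤ |δ| * ‖iteratedDeriv i Δ 0‖ := mul_le_mul_of_nonneg_right hσδ (norm_nonneg _)
      linarith
  -- mean value on `[0, δ]`
  have hMVT := (convex_uIcc (0 : ℝ) δ).norm_image_sub_le_of_norm_hasDerivWithin_le
    (f := fun σ : ℝ => iteratedFDeriv ℝ n P (q + σ • w) (fun _ => v)) (fun σ _ => (hg σ).hasDerivWithinAt) hbound left_mem_uIcc right_mem_uIcc
  rw [hg_eq δ, hg_eq 0, sub_zero, Real.norm_eq_abs, Real.norm_eq_abs] at hMVT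
  have e0 : (fun t : ℝ => f (X t + (0 : ℝ) • Δ t)) = fun t : ℝ => f (X t) := by funext t; rw [zero_smul, add_zero]
  rw [e0] at hMVT
  linarith [hMVT, mul_comm (|δ|) ((n + 1).factorial * K * D ^ (n + 1))]

end Compare

end Summit.HubbardSuperconductivity.HubbardSuperconductivity.Theorems.C4a

end
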